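import Summits.AtomisticToContinuum.HydrodynamicLimit.Theorems.ImplosionDichotomyPolynomialCompressionLevel3IntegratedRate
import Summits.AtomisticToContinuum.HydrodynamicLimit.Theorems.ImplosionDichotomyPolynomialCompressionEnergyShellIntegral
import Summits.AtomisticToContinuum.HydrodynamicLimit.Theorems.ImplosionDichotomyPolynomialCompressionShadowRegularity
import Summits.AtomisticToContinuum.HydrodynamicLimit.Theorems.ImplosionDichotomyPolynomialCompressionLevel0Contract
import Summits.AtomisticToContinuum.HydrodynamicLimit.Theorems.ImplosionDichotomyPolynomialCompressionPcSetting

/-!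
# Level-3 contract `L3` (line `log-lipschitz-budget`, stub 4)

Helper file for the crux `ImplosionDichotomy.PolynomialCompression` (stmt-AtomisticToContinuum-12587), stub
`stub_logBudgetShadowing`. The level-3 analogue of `level0_contract`, in the form consumed by the close: in the common
setting and the weak bootstrap regime on `[0, t₀]`, given the normalised bounds of the LOWER levels
`√E_k ≤ σ³ Q_in X^{b_in}` (`k = 0, 1, 2`, `X = T₁/(T₁ - s)`), sup smallness `l3m0, l3m1 ≤ σ³ Q_S X^{b_S}` and the window
`σ³ (Q_S + 1) X^N ≤ 1`, the level-3 energy obeys `√E₃ ≤ σ³ β (1 + Q_in) X^{b_in + c₀}` with `β, c₀` depending only on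
the setting constants (NOT on `Q_in, b_in, Q_S, b_S`; `N` depends on `b_S`). Proof: `level3_integrated_rate` with
`S₀ = S₁ = σ³ Q_S X^{b_S}`, the window absorbs every small coefficient into a bounded `∫ Λ`, the energy shell
`torus_energy_le_of_integral_rate` on `[0, t₀)`, the initial smallness `√E₃(0) ≤ σ³ C_init` from the statics `Cstat 3`,
normalisation of the polynomial envelope against `X`, and the endpoint `t₀` by continuity of `E₃`.
-/

noncomputable section

namespace Summit.AtomisticToContinuum.HydrodynamicLimit.Theorems

open Set MeasureTheory
open Literature.MathematicalPhysics.KineticTheory Literature.Analysis.FunctionSpaces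

/-- **Level-3 contract `L3`** (see the module docstring). [folklore] -/
theorem level3_contract :
    ∀ (K C cZ T₁ cl pl : ℝ) (Cpoly ppoly Cstat : ℕ → ℝ), 0 < K → 0 ≤ C → 0 ≤ cZ → 0 < T₁ → 0 < cl →
      (∀ n, 0 ≤ Cpoly n) → (∀ n, 0 ≤ Cstat n) →
      ∃ β c₀ : ℝ, 0 ≤ β ∧ 0 ≤ c₀ ∧
        ∀ (Qin bin QS bS : ℝ), 0 ≤ Qin → 0 ≤ bin → 0 ≤ QS → 0 ≤ bS →
        ∃ N : ℝ, 0 ≤ N ∧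
          ∀ (σ T t₀ : ℝ) (ρ θ ρ₁ θ₁ : ℝ → T3 → ℝ) (u u₁ : ℝ → T3 → V3) (ζ : ℝ → ℝ) (J : Set ℝ),
            ShadowSetting K C cZ T₁ cl pl Cpoly ppoly Cstat σ T ρ θ ρ₁ θ₁ u u₁ ζ J → ShadowEosHigher cZ σ T ρ ζ →
            t₀ ∈ Ico 0 T → ShadowWeakBootstrap 1 (1 / (8 * (cZ + 1))) T₁ σ ρ θ u ρ₁ θ₁ u₁ t₀ →
            ShadowLevelBound (shadowE0 ζ ρ θ u ρ₁ θ₁ u₁) Qin bin T₁ σ t₀ →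
            ShadowLevelBound (shadowE1 ζ ρ θ u ρ₁ θ₁ u₁) Qin bin T₁ σ t₀ →
            ShadowLevelBound (shadowE2 ζ ρ θ u ρ₁ θ₁ u₁) Qin bin T₁ σ t₀ →
            (∀ s ∈ Icc 0 t₀, ∀ x, l3m0 ρ θ ρ₁ θ₁ u u₁ s x ≤ σ ^ 3 * QS * (T₁ / (T₁ - s)) ^ bS ∧
              l3m1 ρ θ ρ₁ θ₁ u u₁ s x ≤ σ ^ 3 * QS * (T₁ / (T₁ - s)) ^ bS) →
            (∀ s ∈ Icc 0 t₀, σ ^ 3 * (QS + 1) * (T₁ / (T₁ - s)) ^ N ≤ 1) →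
            ShadowLevelBound (shadowE3 ζ ρ θ u ρ₁ θ₁ u₁) (β * (1 + Qin)) (bin + c₀) T₁ σ t₀ := by
  intro K C cZ T₁ cl pl Cpoly ppoly Cstat hK hC hcZ hT₁ hcl hCpoly hCstat
  obtain ⟨Λ, κ, a, hΛ, hκ, HR⟩ := level3_integrated_rate K C cZ hK hC hcZ
  obtain ⟨cb, pb, hcb, hpb, hbase⟩ := l3contract_base_le (ppoly := ppoly) (pl := pl) hK hcl hT₁ hCpoly
  -- the constants
  set MA : ℝ := 4 * K * (cl * T₁ ^ pl) ^ (-(1 / 3 : ℝ)) with hMA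
  set Ci : ℝ := Cstat 3 * Real.sqrt (27 * MA / 2) with hCi
  set c₁ : ℝ := κ * cb ^ a * (2 + cZ) with hc₁
  set c₂ : ℝ := κ * cb ^ a * (6 + cZ) with hc₂
  set β : ℝ := Real.exp (c₁ * T₁ / 2) * (Ci + T₁ * c₂ / 2) with hβ
  have hcba : 0 ≤ κ * cb ^ a := by positivity
  have hc₁0 : 0 ≤ c₁ := by positivity
  have hc₂0 : 0 ≤ c₂ := by positivity
  have hCi0 : 0 ≤ Ci := mul_nonneg (hCstat 3) (Real.sqrt_nonneg _)
  have hβ0 : 0 ≤ β := by positivity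
  refine ⟨β, Λ / 2 + a * pb, hβ0, by positivity, fun Qin bin QS bS hQin hbin hQS hbS => ⟨a * pb + bS, by positivity, ?_⟩⟩
  intro σ T t₀ ρ θ ρ₁ θ₁ u u₁ ζ J hS hH ht₀ hw h0 h1 h2 hsup hwin
  have hS' := hS
  obtain ⟨hE, hE₁, hσ, hσ1, hT, hTT₁, hJ, hζ, hρJ, -, hEos, hIsen, -, -, hfloor, hu0, hθ0, hstat⟩ := hS'
  have h0T : (0 : ℝ) ∈ Ico 0 T := ⟨le_rfl, hT⟩
  have h0t₀ : (0 : ℝ) ∈ Icc 0 t₀ := ⟨le_rfl, ht₀.1⟩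
  have hσ3 : 0 ≤ σ ^ 3 := by positivity
  have hσ31 : σ ^ 3 ≤ 1 := pow_le_one₀ hσ.le hσ1
  have hts : ∀ t ∈ Icc 0 t₀, t ∈ Ico 0 T := fun t ht => ⟨ht.1, ht.2.trans_lt ht₀.2⟩
  -- the weak regime: positivity of the weights on `[0, t₀]`
  have hwts : ∀ t ∈ Icc 0 t₀, ∀ x, 0 ≤ shadowWeightA ζ ρ θ t x ∧ 0 ≤ ρ t x ∧ 0 ≤ shadowWeightB ρ θ t x := by
    intro t ht x
    have htT := hts t ht
    have hρ := hE.density_pos t htT x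
    have hθ := hE.temperature_pos t htT x
    obtain ⟨-, -, hpk⟩ := hw.1 t ht x
    obtain ⟨e1, e2, -⟩ := hEos t htT x
    have hcz : cZ * (ρ t x * σ ^ 3) ≤ 1 / 8 := by
      have h8 : cZ * (1 / (8 * (cZ + 1))) ≤ 1 / 8 := by
        rw [mul_one_div, div_le_div_iff₀ (by positivity) (by norm_num)]; nlinarith
      exact (mul_le_mul_of_nonneg_left hpk hcZ).trans h8
    have hγ : 0 ≤ ζ (ρ t x) + ρ t x * deriv ζ (ρ t x) := by
      have a1 := (abs_le.1 (e1.trans hcz)).1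
      have a2 := (abs_le.1 (e2.trans hcz)).1
      linarith
    refine ⟨?_, hρ.le, ?_⟩
    · show 0 ≤ θ t x * (ζ (ρ t x) + ρ t x * deriv ζ (ρ t x)) / ρ t x; positivity
    · show 0 ≤ 3 / 2 * ρ t x / θ t x; positivity
  -- the initial bound `√E₃(0) ≤ σ³ C_i`
  have hinit : Real.sqrt (shadowE3 ζ ρ θ u ρ₁ θ₁ u₁ 0) ≤ σ ^ 3 * Ci := by
    have hA : ∀ x, 0 ≤ shadowWeightA ζ ρ θ 0 x ∧ shadowWeightA ζ ρ θ 0 x ≤ MA := by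
      intro x
      have hρ₁ := hE₁.density_pos 0 h0T x
      have hρ := hE.density_pos 0 h0T x
      obtain ⟨hc, hρ₁c, hθ₁c, -⟩ := isentropic_pointwise_algebra hK hρ₁ (hIsen 0 h0T x)
      generalize hcdef : ρ₁ 0 x ^ (1 / 3 : ℝ) = c at hc hρ₁c hθ₁c
      obtain ⟨hw1, hw2, hpk⟩ := hw.1 0 h0t₀ x
      obtain ⟨e1, e2, -⟩ := hEos 0 h0T x
      have hcz : cZ * (ρ 0 x * σ ^ 3) ≤ 1 / 8 := by
        have h8 : cZ * (1 / (8 * (cZ + 1))) ≤ 1 / 8 := by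
          rw [mul_one_div, div_le_div_iff₀ (by positivity) (by norm_num)]; nlinarith
        exact (mul_le_mul_of_nonneg_left hpk hcZ).trans h8
      rw [hρ₁c] at hw1; rw [hθ₁c] at hw2
      obtain ⟨-, -, p3, p4, -⟩ := lbClose_point_facts hK hc le_rfl le_rfl rfl rfl hw1 hw2 (e1.trans hcz) (e2.trans hcz)
      have hfl : (cl * T₁ ^ pl) ^ (1 / 3 : ℝ) ≤ c := by
        rw [← hcdef]
        exact Real.rpow_le_rpow (by positivity) (by simpa only [sub_zero] using hfloor 0 h0T x) (by norm_num)
      have hflpos : 0 < (cl * T₁ ^ pl) ^ (1 / 3 : ℝ) := by positivity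
      have hMA' : 4 * K / c ≤ MA := by
        rw [hMA, Real.rpow_neg (by positivity), ← div_eq_mul_inv]
        exact div_le_div_of_nonneg_left (by positivity) hflpos hfl
      exact ⟨(hwts 0 h0t₀ x).1, p4.trans hMA'⟩
    exact (pcClose_init_energies hE hE₁ hT hu0 hθ0 hσ.le hCstat hA hstat).2.2
  -- the claim at `s ∈ [0, t₀]`
  intro s hs
  have hsT : s < T := lt_of_le_of_lt hs.2 ht₀.2
  have hsT₁ : s < T₁ := hsT.trans_le hTT₁
  have hXs : 1 ≤ T₁ / (T₁ - s) := by rw [le_div_iff₀ (sub_pos.2 hsT₁)]; linarith [hs.1]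
  have hQ1 : 1 ≤ 1 + Qin := by linarith
  have hq0 : 0 ≤ (a : ℝ) * pb + bin := by positivity
  have hG0c : 0 ≤ σ ^ 3 * c₂ * (1 + Qin) := by positivity
  have hSc : 0 ≤ σ ^ 3 * QS := by positivity
  rcases hs.1.eq_or_lt with h0s | hs0
  · -- `s = 0`
    subst h0s
    have h1 : 1 ≤ (T₁ / (T₁ - 0)) ^ (bin + (Λ / 2 + a * pb)) := Real.one_le_rpow hXs (by positivity)
    have hCiβ : Ci ≤ β * (1 + Qin) := by
      have e1 : 1 ≤ Real.exp (c₁ * T₁ / 2) := Real.one_le_exp (by positivity)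
      calc Ci ≤ Ci + T₁ * c₂ / 2 := by linarith [mul_nonneg hT₁.le hc₂0]
        _ ≤ Real.exp (c₁ * T₁ / 2) * (Ci + T₁ * c₂ / 2) :=
            le_mul_of_one_le_left (by linarith [mul_nonneg hT₁.le hc₂0]) e1
        _ ≤ β * (1 + Qin) := le_mul_of_one_le_right hβ0 hQ1
    calc Real.sqrt (shadowE3 ζ ρ θ u ρ₁ θ₁ u₁ 0) ≤ σ ^ 3 * Ci := hinit
      _ ≤ σ ^ 3 * (β * (1 + Qin)) * 1 := by rw [mul_one]; exact mul_le_mul_of_nonneg_left hCiβ hσ3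
      _ ≤ σ ^ 3 * (β * (1 + Qin)) * (T₁ / (T₁ - 0)) ^ (bin + (Λ / 2 + a * pb)) :=
          mul_le_mul_of_nonneg_left h1 (by positivity)
  · -- `0 < s ≤ t₀ < T`: the energy shell on `[0, s)` and the limit `t → s⁻`
    have hsub : Ico 0 s ⊆ Ico 0 T := Ico_subset_Ico_right hsT.le
    have hsub' : ∀ t ∈ Ico 0 s, t ∈ Icc 0 t₀ := fun t ht => ⟨ht.1, ht.2.le.trans hs.2⟩
    have hlap : ∀ t ∈ Ico 0 s, 0 < T₁ - t := fun t ht => sub_pos.2 (ht.2.trans hsT₁)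
    -- the energy density and its data
    have he : Torus.IsSmoothSpaceTimeOn (Ico 0 s) (l3e3 ζ ρ θ ρ₁ θ₁ u u₁) :=
      (isSmoothSpaceTimeOn_shadowE3_integrand hE hE₁ hJ hζ hρJ).mono hsub
    have he0 : ∀ t ∈ Ico 0 s, ∀ x, 0 ≤ l3e3 ζ ρ θ ρ₁ θ₁ u u₁ t x := by
      intro t ht x
      obtain ⟨wA, wρ, wB⟩ := hwts t (hsub' t ht) x
      unfold l3e3 l3e
      refine Finset.sum_nonneg fun n _ => Finset.sum_nonneg fun m _ => Finset.sum_nonneg fun l _ => ?_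
      have hA : 0 ≤ θ t x * (ζ (ρ t x) + ρ t x * deriv ζ (ρ t x)) / ρ t x := wA
      have hB : 0 ≤ 3 / 2 * ρ t x / θ t x := wB
      positivity
    have hE3 : ∀ t, (∫ x, l3e3 ζ ρ θ ρ₁ θ₁ u u₁ t x) = shadowE3 ζ ρ θ u ρ₁ θ₁ u₁ t := fun t => rfl
    -- the rate and forcing functions of the shell
    have hΛc : ContinuousOn (fun t : ℝ => Λ / (T₁ - t) + c₁) (Ico 0 s) :=
      (continuousOn_const.div (continuousOn_const.sub continuousOn_id) fun t ht => (hlap t ht).ne').add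
        continuousOn_const
    have hXc : ContinuousOn (fun t : ℝ => T₁ / (T₁ - t)) (Ico 0 s) :=
      continuousOn_const.div (continuousOn_const.sub continuousOn_id) fun t ht => (hlap t ht).ne'
    have hXpos : ∀ t ∈ Ico 0 s, 0 < T₁ / (T₁ - t) := fun t ht => div_pos hT₁ (hlap t ht)
    have hGc : ContinuousOn (fun t : ℝ => σ ^ 3 * c₂ * (1 + Qin) * (T₁ / (T₁ - t)) ^ (a * pb + bin)) (Ico 0 s) :=
      continuousOn_const.mul (hXc.rpow_const fun t ht => Or.inl (hXpos t ht).ne')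
    have hΛ0 : ∀ t ∈ Ico 0 s, 0 ≤ Λ / (T₁ - t) + c₁ := fun t ht =>
      add_nonneg (div_nonneg hΛ (hlap t ht).le) hc₁0
    have hG0 : ∀ t ∈ Ico 0 s, 0 ≤ σ ^ 3 * c₂ * (1 + Qin) * (T₁ / (T₁ - t)) ^ (a * pb + bin) := fun t ht =>
      mul_nonneg hG0c (Real.rpow_nonneg (hXpos t ht).le _)
    -- the integrated rate, dominated through the window
    have hrate : ∀ t ∈ Ico 0 s, ∫ x, Torus.timeDerivWithin (Ico 0 s) (l3e3 ζ ρ θ ρ₁ θ₁ u u₁) t x ≤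
        (Λ / (T₁ - t) + c₁) * (∫ x, l3e3 ζ ρ θ ρ₁ θ₁ u u₁ t x) +
          σ ^ 3 * c₂ * (1 + Qin) * (T₁ / (T₁ - t)) ^ (a * pb + bin) *
            Real.sqrt (∫ x, l3e3 ζ ρ θ ρ₁ θ₁ u u₁ t x) := by
      intro t ht
      have htt₀ := hsub' t ht
      have htT := hsub ht
      have hderiv : (fun x => Torus.timeDerivWithin (Ico 0 s) (l3e3 ζ ρ θ ρ₁ θ₁ u u₁) t x) =
          fun x => Torus.timeDerivWithin (Ico 0 T) (l3e3 ζ ρ θ ρ₁ θ₁ u u₁) t x :=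
        funext fun x => timeDerivWithin_Ico_eq_of_le ht hsT.le _ x
      rw [hderiv, hE3]
      have hr := HR (S₀ := fun r => σ ^ 3 * QS * (T₁ / (T₁ - r)) ^ bS)
        (S₁ := fun r => σ ^ 3 * QS * (T₁ / (T₁ - r)) ^ bS) hcl hCpoly hS hH ht₀ hw
        (fun r hr => ⟨mul_nonneg hSc (Real.rpow_nonneg (div_pos hT₁ (sub_pos.2 ((hts r hr).2.trans_le hTT₁))).le _),
          mul_nonneg hSc (Real.rpow_nonneg (div_pos hT₁ (sub_pos.2 ((hts r hr).2.trans_le hTT₁))).le _),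
          fun x => hsup r hr x⟩) t ⟨ht.1, ht.2.trans_le hs.2⟩
      refine hr.trans ?_
      -- the window at `t`
      obtain ⟨hb0, hbX⟩ := hbase t ht.1 (ht.2.trans hsT₁)
      have hX1 : 1 ≤ T₁ / (T₁ - t) := by rw [le_div_iff₀ (hlap t ht)]; linarith [ht.1]
      have hE30 : 0 ≤ shadowE3 ζ ρ θ u ρ₁ θ₁ u₁ t := by
        rw [← hE3 t]; exact integral_nonneg fun x => he0 t ht x
      have hd := l3contract_dominate (Λl := Λ / (T₁ - t)) (E3 := shadowE3 ζ ρ θ u ρ₁ θ₁ u₁ t)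
        (sE3 := Real.sqrt (shadowE3 ζ ρ θ u ρ₁ θ₁ u₁ t)) hκ hcb hpb hb0 hbX hX1 hσ3 hσ31 hcZ hQS hQin hbS hbin
        (hwin t htt₀) (h0 t htt₀) (h1 t htt₀) (h2 t htt₀) (Real.sqrt_nonneg _) hE30
      exact hd
    -- the shell
    have key := torus_energy_le_of_integral_rate he he0 hΛc hGc hΛ0 hG0 hrate
    -- the normalised bound on `[0, s)`
    have hbound : ∀ t ∈ Ico 0 s, Real.sqrt (shadowE3 ζ ρ θ u ρ₁ θ₁ u₁ t) ≤
        σ ^ 3 * (β * (1 + Qin)) * (T₁ / (T₁ - t)) ^ (bin + (Λ / 2 + a * pb)) := by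
      intro t ht
      have htT₁ : t < T₁ := ht.2.trans hsT₁
      have hl := hlap t ht
      have hXt : 0 < T₁ / (T₁ - t) := hXpos t ht
      have hXt1 : 1 ≤ T₁ / (T₁ - t) := by rw [le_div_iff₀ hl]; linarith [ht.1]
      have hk := key t ht
      rw [hE3, hE3] at hk
      -- `∫₀ᵗ (Λ/(T₁ - r) + c₁) = Λ log X + c₁ t`
      have hint : ∫ r in (0:ℝ)..t, (Λ / (T₁ - r) + c₁) = Λ * Real.log (T₁ / (T₁ - t)) + c₁ * t := by
        have hci : IntervalIntegrable (fun r : ℝ => Λ / (T₁ - r)) MeasureTheory.volume 0 t := by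
          refine (ContinuousOn.div continuousOn_const (continuousOn_const.sub continuousOn_id) fun r hr => ?_).intervalIntegrable
          rw [uIcc_of_le ht.1] at hr
          exact (sub_pos.2 (hr.2.trans_lt htT₁)).ne'
        rw [intervalIntegral.integral_add hci intervalIntegrable_const, intervalIntegral.integral_const, smul_eq_mul,
          sub_zero, mul_comm (t : ℝ) c₁]
        congr 1
        have h1 : ∫ r in (0:ℝ)..t, Λ / (T₁ - r) = Λ * ∫ r in (0:ℝ)..t, (fun v : ℝ => v⁻¹) (T₁ - r) := by
          rw [← intervalIntegral.integral_const_mul]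
          simp only [div_eq_mul_inv]
        rw [h1, intervalIntegral.integral_comp_sub_left (fun v : ℝ => v⁻¹) T₁, sub_zero, integral_inv_of_pos hl hT₁]
      have hexp : Real.exp ((∫ r in (0:ℝ)..t, (Λ / (T₁ - r) + c₁)) / 2) ≤
          (T₁ / (T₁ - t)) ^ (Λ / 2) * Real.exp (c₁ * T₁ / 2) := by
        rw [hint, add_div, Real.exp_add, Real.rpow_def_of_pos hXt]
        refine mul_le_mul (le_of_eq (by congr 1; ring)) (Real.exp_le_exp.2 ?_) (Real.exp_pos _).le
          (Real.exp_pos _).le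
        exact div_le_div_of_nonneg_right (mul_le_mul_of_nonneg_left htT₁.le hc₁0) (by norm_num)
      -- `∫₀ᵗ G ≤ T₁ G(t)`
      have hGint : ∫ r in (0:ℝ)..t, σ ^ 3 * c₂ * (1 + Qin) * (T₁ / (T₁ - r)) ^ (a * pb + bin) ≤
          T₁ * (σ ^ 3 * c₂ * (1 + Qin) * (T₁ / (T₁ - t)) ^ (a * pb + bin)) := by
        have hmono : ∀ r ∈ Icc 0 t, σ ^ 3 * c₂ * (1 + Qin) * (T₁ / (T₁ - r)) ^ (a * pb + bin) ≤
            σ ^ 3 * c₂ * (1 + Qin) * (T₁ / (T₁ - t)) ^ (a * pb + bin) := by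
          intro r hr
          have hlr : 0 < T₁ - r := by linarith [hr.2]
          have hXr : T₁ / (T₁ - r) ≤ T₁ / (T₁ - t) := div_le_div_of_nonneg_left hT₁.le hl (by linarith [hr.2])
          exact mul_le_mul_of_nonneg_left (Real.rpow_le_rpow (div_pos hT₁ hlr).le hXr hq0) hG0c
        have hcr : ContinuousOn (fun r : ℝ => σ ^ 3 * c₂ * (1 + Qin) * (T₁ / (T₁ - r)) ^ (a * pb + bin)) (uIcc 0 t) := by
          rw [uIcc_of_le ht.1]
          refine continuousOn_const.mul ((continuousOn_const.div (continuousOn_const.sub continuousOn_id)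
            fun r hr => ?_).rpow_const fun r hr => Or.inl ?_)
          · exact (sub_pos.2 (hr.2.trans_lt htT₁)).ne'
          · exact (div_pos hT₁ (sub_pos.2 (hr.2.trans_lt htT₁))).ne'
        calc ∫ r in (0:ℝ)..t, σ ^ 3 * c₂ * (1 + Qin) * (T₁ / (T₁ - r)) ^ (a * pb + bin)
            ≤ ∫ r in (0:ℝ)..t, σ ^ 3 * c₂ * (1 + Qin) * (T₁ / (T₁ - t)) ^ (a * pb + bin) :=
              intervalIntegral.integral_mono_on ht.1 hcr.intervalIntegrable intervalIntegrable_const hmono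
          _ = t * (σ ^ 3 * c₂ * (1 + Qin) * (T₁ / (T₁ - t)) ^ (a * pb + bin)) := by
              rw [intervalIntegral.integral_const, smul_eq_mul, sub_zero]
          _ ≤ T₁ * (σ ^ 3 * c₂ * (1 + Qin) * (T₁ / (T₁ - t)) ^ (a * pb + bin)) :=
              mul_le_mul_of_nonneg_right htT₁.le (hG0 t ht)
      -- assemble
      have hXq : 1 ≤ (T₁ / (T₁ - t)) ^ (a * pb + bin) := Real.one_le_rpow hXt1 hq0
      have hfin := l3contract_assemble hk hexp hGint hinit hXq (Real.rpow_nonneg hXt.le _) (Real.exp_pos _).le hσ3 hCi0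
        hQin (Real.sqrt_nonneg _) (intervalIntegral.integral_nonneg ht.1 fun r hr => hG0 r ⟨hr.1, hr.2.trans_lt ht.2⟩)
      rw [← Real.rpow_add hXt] at hfin
      have e : (a : ℝ) * pb + bin + Λ / 2 = bin + (Λ / 2 + a * pb) := by ring
      rw [e] at hfin
      rw [hβ]
      exact hfin
    -- pass to the limit `t → s⁻`
    have hcont : ContinuousOn (shadowE3 ζ ρ θ u ρ₁ θ₁ u₁) (Ico 0 T) := continuousOn_shadowE3 hE hE₁ hJ hζ hρJ
    have hf : ContinuousWithinAt (fun t => Real.sqrt (shadowE3 ζ ρ θ u ρ₁ θ₁ u₁ t)) (Ico 0 s) s :=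
      (hcont.sqrt s ⟨hs.1, hsT⟩).mono hsub
    have hg : ContinuousWithinAt (fun t => σ ^ 3 * (β * (1 + Qin)) * (T₁ / (T₁ - t)) ^ (bin + (Λ / 2 + a * pb)))
        (Ico 0 s) s := by
      refine ContinuousAt.continuousWithinAt ?_
      refine continuousAt_const.mul (ContinuousAt.rpow_const ?_ (Or.inr (by positivity)))
      exact continuousAt_const.div (continuousAt_const.sub continuousAt_id) (sub_pos.2 hsT₁).ne'
    have hclos : s ∈ closure (Ico 0 s) := by
      rw [closure_Ico hs0.ne]
      exact right_mem_Icc.2 hs0.le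
    exact ContinuousWithinAt.closure_le hclos hf hg hbound

end Summit.AtomisticToContinuum.HydrodynamicLimit.Theorems

end
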